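import Mathlib

/-!
# Tier 3, T3.2 — R-B (FINDING 2's endgame, ADDENDUM-4 §A21 (2)): the torsion of the `𝔭`-line group
(seat t3-p3, gen 5; blind re-derivation cell `pub-hodge-repro`; paper: proofs/t3-p3/R2-PINNING-ADDENDUM-4.md §A21)

Burungale–Hida's `𝔭`-anticyclotomic group is `Γ⁻_𝔭 = Γ⁻ ⧸ H` with `Γ⁻ ≅ ℤ_p^d` and `H` the closure of the inertia
groups at the primes above `p` not above `𝔭`.  The cell's chain identifies `ℤ_p⟦Γ⁻_𝔭⟧` with `ℤ_p⟦X⟧`, which needs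
`Γ⁻_𝔭` torsion-free.  §A21 (2) shows: `H ≤ Γ₀ ≤ Γ⁻` with `Γ₀ = ⊕ ℤ_p e_𝔮` the image of the principal units and
`H = ⊕_{𝔮 ≠ 𝔭} ℤ_p e_𝔮` the span of a sub-basis, so `Γ₀ ⧸ H ≅ ℤ_p` is torsion-free, and the torsion of `Γ⁻ ⧸ H`
injects into the finite group `Γ⁻ ⧸ Γ₀` (a quotient of the `p`-part of a minus ray class group) — trivial as soon as
`p` does not divide that class number.  This file types the module theory of that sentence:

* `eq_zero_of_mem_torsion_of_mem_map` — a torsion element of `M ⧸ N` in the image of `N₀` is `0` when `N₀ ⧸ N` is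
  torsion-free (elementwise: `r ≠ 0`, `y ∈ N₀`, `r • y ∈ N ⇒ y ∈ N`);
* `factor_injOn_torsion` — hence the torsion submodule of `M ⧸ N` maps INJECTIVELY to `M ⧸ N₀` (`T_𝔭 ↪ Γ⁻ ⧸ Γ₀`);
* `torsion_eq_bot_of_map_eq_top` — if moreover `N₀` maps onto `M ⧸ N` (`Γ₀ = Γ⁻`), then `M ⧸ N` is torsion-free;
* `smul_mem_span_image_iff`, `mem_span_image_of_smul_mem_span_image` — the span of a SUB-BASIS `b '' S` of a free
  module satisfies the elementwise condition (`Γ₀ ⧸ H` torsion-free);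
* `isTorsionFree_quotient_ker_of_surjective`, `isTorsionFree_quotient_ker_proj` — `M ⧸ ker f` is torsion-free for a
  surjection `f` onto a torsion-free module; in particular `(ι → R) ⧸ ker (proj i₀) ≅ R` (the line `ℤ_p e_𝔭`).

HONESTY.  Pure module theory over a commutative ring / domain; which subgroups of the Galois group are the inertia images, that
`Γ₀ ≅ ⊕ ℤ_p e_𝔮`, and that `Γ⁻ ⧸ Γ₀` is a quotient of the `p`-part of `Cl_{E′}(ℭ_j)⁻` are class field theory on paper
(§A21 (2)).  Nothing here says anything about the status of the Hodge conjecture for CM abelian varieties, which is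
NOT proved.
-/

set_option autoImplicit false

open Submodule

namespace Summit.Ventures.HodgeRepro.T3.PadicLineTorsion

section Injectivity

variable {R : Type*} [CommRing R] [IsDomain R]
variable {M : Type*} [AddCommGroup M] [Module R M]

/-- A torsion element of `M ⧸ N` lying in the image of `N₀` is `0`, provided `N₀ ⧸ N` is torsion-free in the
elementwise sense `r ≠ 0 → y ∈ N₀ → r • y ∈ N → y ∈ N`. -/
theorem eq_zero_of_mem_torsion_of_mem_map {N N₀ : Submodule R M}
    (htf : ∀ y ∈ N₀, ∀ r : R, r ≠ 0 → r • y ∈ N → y ∈ N)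
    {x : M ⧸ N} (hx : x ∈ torsion R (M ⧸ N)) (hx₀ : x ∈ N₀.map N.mkQ) : x = 0 := by
  obtain ⟨y, hy, rfl⟩ := mem_map.mp hx₀
  obtain ⟨a, ha⟩ := (mem_torsion_iff _).mp hx
  have h1 : (a : R) • y ∈ N := by
    have h : N.mkQ ((a : R) • y) = 0 := by
      rw [map_smul]
      exact ha
    rwa [mkQ_apply, Quotient.mk_eq_zero] at h
  rw [mkQ_apply, Quotient.mk_eq_zero]
  exact htf y hy a (nonZeroDivisors.coe_ne_zero a) h1

/-- **`T_𝔭 ↪ Γ⁻ ⧸ Γ₀`.** For `N ≤ N₀` with `N₀ ⧸ N` torsion-free, the map `M ⧸ N → M ⧸ N₀` is injective on the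
torsion submodule of `M ⧸ N`. -/
theorem factor_injOn_torsion {N N₀ : Submodule R M} (hN : N ≤ N₀)
    (htf : ∀ y ∈ N₀, ∀ r : R, r ≠ 0 → r • y ∈ N → y ∈ N) :
    Set.InjOn (factor hN) (torsion R (M ⧸ N)) := by
  intro x₁ hx₁ x₂ hx₂ h
  have hsub : x₁ - x₂ ∈ torsion R (M ⧸ N) := (torsion R (M ⧸ N)).sub_mem hx₁ hx₂
  obtain ⟨z, hz⟩ := N.mkQ_surjective (x₁ - x₂)
  have hz0 : factor hN (N.mkQ z) = 0 := by
    rw [hz, map_sub, h, sub_self]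
  have hzN₀ : z ∈ N₀ := by
    rwa [factor_mk, mkQ_apply, Quotient.mk_eq_zero] at hz0
  have hker : x₁ - x₂ ∈ N₀.map N.mkQ := by
    rw [← hz]
    exact mem_map.mpr ⟨z, hzN₀, rfl⟩
  exact sub_eq_zero.mp (eq_zero_of_mem_torsion_of_mem_map htf hsub hker)

/-- **`Γ₀ = Γ⁻ ⇒ T_𝔭 = 1`.** If `N₀` maps onto `M ⧸ N` and `N₀ ⧸ N` is torsion-free, then `M ⧸ N` is
torsion-free. -/
theorem torsion_eq_bot_of_map_eq_top {N N₀ : Submodule R M}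
    (htf : ∀ y ∈ N₀, ∀ r : R, r ≠ 0 → r • y ∈ N → y ∈ N) (htop : N₀.map N.mkQ = ⊤) :
    torsion R (M ⧸ N) = ⊥ := by
  rw [eq_bot_iff]
  intro x hx
  rw [mem_bot]
  exact eq_zero_of_mem_torsion_of_mem_map htf hx (htop ▸ mem_top)

end Injectivity

section SubBasis

variable {R : Type*} [CommRing R] [IsDomain R]
variable {M : Type*} [AddCommGroup M] [Module R M]
variable {ι : Type*} (b : Module.Basis ι R M) (S : Set ι)

/-- Membership of `r • y` in the span of a sub-basis, `r ≠ 0`, is membership of `y`. -/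
theorem smul_mem_span_image_iff {y : M} {r : R} (hr : r ≠ 0) :
    r • y ∈ span R (b '' S) ↔ y ∈ span R (b '' S) := by
  rw [Module.Basis.mem_span_image, Module.Basis.mem_span_image, map_smul,
    Finsupp.support_smul_eq hr]

/-- **`Γ₀ ⧸ H` torsion-free.** The span of a sub-basis satisfies the elementwise torsion-freeness hypothesis of
`factor_injOn_torsion` (with `N₀ = ⊤`, or any `N₀`). -/
theorem mem_span_image_of_smul_mem_span_image {y : M} {r : R} (hr : r ≠ 0)
    (h : r • y ∈ span R (b '' S)) : y ∈ span R (b '' S) :=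
  (smul_mem_span_image_iff b S hr).mp h

end SubBasis

section Quotient

variable {R : Type*} [CommRing R]
variable {M P : Type*} [AddCommGroup M] [Module R M] [AddCommGroup P] [Module R P]

/-- `M ⧸ ker f` is torsion-free for a surjection `f` onto a torsion-free module. -/
theorem isTorsionFree_quotient_ker_of_surjective [Module.IsTorsionFree R P] (f : M →ₗ[R] P)
    (hf : Function.Surjective f) : Module.IsTorsionFree R (M ⧸ LinearMap.ker f) :=
  Function.Injective.moduleIsTorsionFree (f.quotKerEquivOfSurjective hf)
    (f.quotKerEquivOfSurjective hf).injective (fun r m => map_smul _ r m)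

/-- **The line `ℤ_p e_𝔭`.** `(ι → R) ⧸ ker (proj i₀)` is torsion-free: the quotient of a free module by the
coordinate hyperplane `{g | g i₀ = 0}` is `R`. -/
theorem isTorsionFree_quotient_ker_proj {ι : Type*} (i₀ : ι) :
    Module.IsTorsionFree R ((ι → R) ⧸ LinearMap.ker (LinearMap.proj i₀ : (ι → R) →ₗ[R] R)) :=
  isTorsionFree_quotient_ker_of_surjective _ (fun r => ⟨fun _ => r, rfl⟩)

end Quotient

end Summit.Ventures.HodgeRepro.T3.PadicLineTorsion
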